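import Summits.HodgeConjecture.HodgeConjecture.Theorems.F0AlbCmS1OneZeroLift
import Literature.AlgebraicGeometry.ShimuraVarieties.UnitaryShimuraCurveConeRealisationCarriers
import Literature.AlgebraicGeometry.ShimuraVarieties.UnitaryCurveConeReadClassInjective
import Summits.HodgeConjecture.HodgeConjecture.Theorems.HLiu418CurveHodgeTypesDisjoint
import Summits.HodgeConjecture.CorCM.HypLiu418.AlbaneseH1ComparisonOfLemma24
import Summits.HodgeConjecture.HodgeConjecture.Theorems.F0AlbCmBettiLevelRecordTransport
import HarnessLib

/-!
# Crux `HLiu418`, line `F0_AlbCm`, sub-sub-line `F0_AlbCmS1Betti` — M5-glue part 2: the level-wise realisation of the GS Betti levels by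
# cohomological automorphic forms (`S1LevelRealisationShape`, i.e. ed. 2's `stub_S1_levelRealisation`, PROVED as `s1LevelRealisation`)

Floor-0 programme P5 (Alb-CM), seat F0P5-p01 (g0); crux item stmt-HodgeConjecture-24832 (`HCCMUnconditional.HLiu418`).  THEOREMS ONLY,
letter-free and `sorry`-free.  HC_CM is proved only modulo the 7 printed citations until rung 0 closes.  Part 1 = ★
`Theorems/F0AlbCmS1OneZeroLift.lean` (the `(1,0)`-lift maps `Φ_K`, frame helpers).
* §4 `f⁰_K[z] := Φ_K[z] + conj Φ_K[conj z]`: (V) `addConj_mem_cohForms₂` (★ F2-V `lift_mem_cohForms₂`); (I) `eq_zero_of_addConj_eq_zero` (★ (D)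
  `disjoint_holCotForms₂_map_conjFun₂` with the orientation cases ★ `lift_mem_holCotForms₂_of_embedding_eq` ∕
  `conjFun₂_lift_mem_holCotForms₂_of_embedding_ne`, ★ R6c `eq_zero_of_forall_coneRead_archLocal_eq_zero`, cofan detection ★
  `complexBetti_eq_zero_of_forall_map_inj`).
* §5 (H) `addConj_heckePullback`: `f⁰_K[T_g^* z] = R(g) f⁰_{K'}[z]` (★ F2-H∕M4 `lift_heckePullback_eq_rightTranslate`, ★ `exists_rep_inv_mul_mem`,
  ★ `conjClass_complexBetti_map`, ★ `conjFun₂_rightRep₂`).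
* §6 `s1LevelRealisation` = the statement of `F0AlbCmS1Betti.S1LevelRealisationShape` (pasted binders; the line folds it by name): `f_K := f⁰_K ∘ tr_K`
  with ★ M5-tr `BettiLevelRecordTransport.exists_bettiLevelRecordTransport`, at the record's chosen Hecke translates
  (★ `isHeckeTranslate_recordHeckeTranslateGS`).
[cite: Liu2021, §D.3 l. 5300–5359 and §4.2 l. 2066–2081] [cite: BorelJacquet1979, §4.3] [cite: BorelWallach2000, VII 2.10, 3.2, 3.6 and XIII 1.2]
[cite: Borel1997, §5.13–§5.14] [cite: Milne2005ShimuraVarieties, Thm. 13.6 p. 118] [cite: VoisinHodgeI2002, §7.1.1 Cor. 7.6]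
-/

set_option autoImplicit false
set_option linter.dupNamespace false

noncomputable section

open Function MulAction Topology NumberField CategoryTheory Matrix AlgebraicGeometry
open scoped Matrix ComplexOrder Manifold
open Literature.AlgebraicGeometry.Motives
open Literature.NumberTheory.Automorphic Literature.NumberTheory.Automorphic.UnitaryGroup
open Literature.NumberTheory.Automorphic.UnitaryCurveForms
open Literature.NumberTheory.Automorphic.Liu2021.AppendixC (C5.OpenCompactSubgroup C5.SmallLevel)
open Literature.AlgebraicGeometry.HodgeTheory
open Literature.Geometry.Kaehler (MForm)
open Literature.AlgebraicTopology.SingularHomology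
open Literature.AlgebraicGeometry.ShimuraVarieties Literature.AlgebraicGeometry.ShimuraVarieties.UnitaryCanonicalModel

open Summit.HodgeConjecture.HodgeConjecture.Cruxes.HLiu418.S1OneZeroLift

namespace Summit.HodgeConjecture.HodgeConjecture.Cruxes.HLiu418.S1LevelRealisation

variable {L : Type} [Field L] [NumberField L] [IsCMField L] {Jstar : Matrix (Fin 2) (Fin 2) L} {τ : L →+* ℂ}
  {K₀ : C5.OpenCompactSubgroup ↥(finAdelic (↥(maximalRealSubfield L)) L (IsCMField.complexConj L) 2 Jstar)}
  {S : RecordSystemGS L Jstar τ K₀} {K : C5.SmallLevel K₀}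
  {gq : orbitRel.Quotient ↥(rational (↥(maximalRealSubfield L)) L (IsCMField.complexConj L) 2 Jstar)
      (ShimuraDissection.CosetSpace (rationalToFinAdelic (↥(maximalRealSubfield L)) L (IsCMField.complexConj L) 2 Jstar) K.1.1) →
    ↥(finAdelic (↥(maximalRealSubfield L)) L (IsCMField.complexConj L) 2 Jstar)}
  {X : orbitRel.Quotient ↥(rational (↥(maximalRealSubfield L)) L (IsCMField.complexConj L) 2 Jstar)
      (ShimuraDissection.CosetSpace (rationalToFinAdelic (↥(maximalRealSubfield L)) L (IsCMField.complexConj L) 2 Jstar) K.1.1) →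
    SchemeOver ℂ}
  {ι : ∀ q, X q ⟶ (letI : Algebra L ℂ := τ.toAlgebra; (Literature.AlgebraicGeometry.Motives.baseChangeHom τ).obj (S.M.obj K))}
  {B : ∀ q, UnitaryBallUniformisationDatum 1 (X q)}

/-! ## §4 Per level: the record-side realisation `f⁰_K[z] = Φ_K[z] + conj (Φ_K[conj z])` — values (V) and injectivity (I) -/

set_option maxHeartbeats 1600000 in
/-- **(V) per level**: for a `(1,0)`-lift map `Φ_K` (the four clauses of `exists_oneZeroLiftMap` at the frame `(𝔣.v₀, 𝔣.t₀)` untwisted),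
`Φ_K[z] + conj (Φ_K[conj z]) ∈ cohForms₂ 𝔣` (★ F2-V `lift_mem_cohForms₂`, `cohForms₂` conj-stable). [cite: Borel1997, §5.14]
[cite: BorelWallach2000, VII 2.10 and 3.6] -/
theorem addConj_mem_cohForms₂
    (hgq : ∀ q, Quotient.mk'' (ShimuraDissection.CosetSpace.pt
      (rationalToFinAdelic (↥(maximalRealSubfield L)) L (IsCMField.complexConj L) 2 Jstar) K.1.1 (gq q)) = q)
    (hB : ∀ q, (B q).Hℂ = Jstar.map τ) (𝔣 : ConeFrame L Jstar (cmPlace L τ))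
    {Φ : letI : Algebra L ℂ := τ.toAlgebra
      complexBetti ((Literature.AlgebraicGeometry.Motives.baseChangeHom τ).obj (S.M.obj K)) 1 →ₗ[ℂ] ((adelicGroupData (↥(maximalRealSubfield L)) L (IsCMField.complexConj L) 2 Jstar).Adelic → ℂ)}
    (hΦ : letI : Algebra L ℂ := τ.toAlgebra
      ∀ z : complexBetti ((Literature.AlgebraicGeometry.Motives.baseChangeHom τ).obj (S.M.obj K)) 1,
        let v₀ : Fin 2 → ℂ := fun i => embTwist L τ (𝔣.v₀ i)
        let t₀ : Fin 2 → ℂ := fun i => embTwist L τ (𝔣.t₀ i)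
        (∀ (δ : ↥(rational (↥(maximalRealSubfield L)) L (IsCMField.complexConj L) 2 Jstar)) (x : (adelicGroupData (↥(maximalRealSubfield L)) L (IsCMField.complexConj L) 2 Jstar).Adelic),
          Φ z ((adelicGroupData (↥(maximalRealSubfield L)) L (IsCMField.complexConj L) 2 Jstar).toAdelic δ * x) = Φ z x) ∧
        (∀ k ∈ ((archAt (↥(maximalRealSubfield L)) L (IsCMField.complexConj L) 2 Jstar (cmPlace L τ)
              (UnitaryGroup.complexConj_smul_infinitePlace L _) (IsCMField.complexConj_ne_one L)).ker).map
            (archToAdelic (↥(maximalRealSubfield L)) L (IsCMField.complexConj L) 2 Jstar),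
          ∀ x : (adelicGroupData (↥(maximalRealSubfield L)) L (IsCMField.complexConj L) 2 Jstar).Adelic, Φ z (x * k) = Φ z x) ∧
        (∀ k ∈ K.1.1, ∀ x : (adelicGroupData (↥(maximalRealSubfield L)) L (IsCMField.complexConj L) 2 Jstar).Adelic,
          Φ z (x * finAdelicToAdelic (↥(maximalRealSubfield L)) L (IsCMField.complexConj L) 2 Jstar k) = Φ z x) ∧
        ∀ (q : orbitRel.Quotient ↥(rational (↥(maximalRealSubfield L)) L (IsCMField.complexConj L) 2 Jstar)
          (ShimuraDissection.CosetSpace (rationalToFinAdelic (↥(maximalRealSubfield L)) L (IsCMField.complexConj L) 2 Jstar) K.1.1))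
          (u : archLocal L 2 Jstar (cmPlace L τ)),
          Φ z (adelicSingle (↥(maximalRealSubfield L)) L (IsCMField.complexConj L) 2 Jstar (IsCMField.complexConj_ne_one L)
              (UnitaryGroup.complexConj_smul_infinitePlace L) (cmPlace L τ) u *
            finAdelicToAdelic (↥(maximalRealSubfield L)) L (IsCMField.complexConj L) 2 Jstar (gq q)) =
          (((algebraicModel (B q).isSmoothProjective).oneFormOfClass (B q).isSmoothProjective (algebraicModel (B q).isSmoothProjective).holFormsClosed_top (((algebraicModel (B q).isSmoothProjective).complexification (B q).isSmoothProjective 1).symm ((algebraicModel (B q).isSmoothProjective).pullbackEquiv 1 ((algebraicModel (B q).isSmoothProjective).typeProj 1 ⟨(1, 0), Finset.HasAntidiagonal.mem_antidiagonal.2 rfl⟩ (complexBetti.map (ι q) 1 z)))) : MForm 𝓘(ℝ, (algebraicModel (B q).isSmoothProjective).model) (algebraicModel (B q).isSmoothProjective).carrier ℂ 1)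
          ((⇑(algebraicModel (B q).isSmoothProjective).isAnalytification.homeomorph.symm ∘ (B q).unif)
            ((((u : GL (Fin 2) ℂ) : Matrix (Fin 2) (Fin 2) ℂ).map (embTwist L τ)) *ᵥ v₀))
          (fun _ ↦ mfderiv 𝓘(ℝ, Fin 2 → ℂ) 𝓘(ℝ, (algebraicModel (B q).isSmoothProjective).model)
            (⇑(algebraicModel (B q).isSmoothProjective).isAnalytification.homeomorph.symm ∘ (B q).unif)
            ((((u : GL (Fin 2) ℂ) : Matrix (Fin 2) (Fin 2) ℂ).map (embTwist L τ)) *ᵥ v₀)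
            ((((u : GL (Fin 2) ℂ) : Matrix (Fin 2) (Fin 2) ℂ).map (embTwist L τ)) *ᵥ t₀))))
    (z : letI : Algebra L ℂ := τ.toAlgebra; complexBetti ((Literature.AlgebraicGeometry.Motives.baseChangeHom τ).obj (S.M.obj K)) 1) :
    letI : Algebra L ℂ := τ.toAlgebra
    Φ z + conjFun₂ (↥(maximalRealSubfield L)) L (IsCMField.complexConj L) Jstar (Φ (conjClass _ 1 z)) ∈ cohForms₂ (↥(maximalRealSubfield L)) L (IsCMField.complexConj L) Jstar (IsCMField.complexConj_ne_one L) (UnitaryGroup.complexConj_smul_infinitePlace L) (cmPlace L τ) 𝔣 := by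
  letI : Algebra L ℂ := τ.toAlgebra
  have hcov := cover_of_representatives (K := K.1.1) (hgq := hgq)
  have hmem : ∀ z : complexBetti ((Literature.AlgebraicGeometry.Motives.baseChangeHom τ).obj (S.M.obj K)) 1, Φ z ∈ cohForms₂ (↥(maximalRealSubfield L)) L (IsCMField.complexConj L) Jstar (IsCMField.complexConj_ne_one L) (UnitaryGroup.complexConj_smul_infinitePlace L) (cmPlace L τ) 𝔣 := fun z =>
    lift_mem_cohForms₂ 𝔣 (coneFrame_v₀_eq L Jstar τ 𝔣) (coneFrame_t₀_eq L Jstar τ 𝔣) hB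
      (fun q => algebraicModel (B q).isSmoothProjective)
      (fun q => ((algebraicModel (B q).isSmoothProjective).oneFormOfClass (B q).isSmoothProjective (algebraicModel (B q).isSmoothProjective).holFormsClosed_top (((algebraicModel (B q).isSmoothProjective).complexification (B q).isSmoothProjective 1).symm ((algebraicModel (B q).isSmoothProjective).pullbackEquiv 1 ((algebraicModel (B q).isSmoothProjective).typeProj 1 ⟨(1, 0), Finset.HasAntidiagonal.mem_antidiagonal.2 rfl⟩ (complexBetti.map (ι q) 1 z)))) : MForm 𝓘(ℝ, (algebraicModel (B q).isSmoothProjective).model) (algebraicModel (B q).isSmoothProjective).carrier ℂ 1))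
      (fun q => Literature.Geometry.Kaehler.isHolomorphicInCharts_of_mem _) hcov (hΦ z).1 (hΦ z).2.1 (hΦ z).2.2.1 (hΦ z).2.2.2
  exact add_mem (hmem z) (conjFun₂_mem_cohForms₂_of_mem _ _ _ _ _ _ _ 𝔣 (hmem _))

set_option maxHeartbeats 1600000 in
/-- **(I) per level**: `Φ_K[z] + conj (Φ_K[conj z]) = 0 ⟹ z = 0`.  The two summands have DISJOINT Hodge types (★ (D)
`disjoint_holCotForms₂_map_conjFun₂`; which summand is holomorphic depends on Mathlib's embedding of the place of `τ`, ★ F2-V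
`lift_mem_holCotForms₂_of_embedding_eq` ∕ `conjFun₂_lift_mem_holCotForms₂_of_embedding_ne`), so both vanish; then every cone read of
`ω_q(ι_q^* z)` and of `ω_q(ι_q^* conj z)` vanishes, so `ι_q^* z = 0` on every piece (★ R6c `eq_zero_of_forall_coneRead_archLocal_eq_zero`) and
`z = 0` (cofan detection ★ `complexBetti_eq_zero_of_forall_map_inj`). [cite: Borel1997, §5.14] [cite: VoisinHodgeI2002, §7.1.1 Cor. 7.6] -/
theorem eq_zero_of_addConj_eq_zero
    (hgq : ∀ q, Quotient.mk'' (ShimuraDissection.CosetSpace.pt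
      (rationalToFinAdelic (↥(maximalRealSubfield L)) L (IsCMField.complexConj L) 2 Jstar) K.1.1 (gq q)) = q)
    (hcol : letI : Algebra L ℂ := τ.toAlgebra
      Limits.IsColimit (Limits.Cofan.mk ((Literature.AlgebraicGeometry.Motives.baseChangeHom τ).obj (S.M.obj K)) ι))
    (hB : ∀ q, (B q).Hℂ = Jstar.map τ ∧
      (B q).Γ.map (Matrix.GeneralLinearGroup.map ((B q).τ₁ : ↥(B q).E →+* ℂ)) =
        (arithmeticLevel (↥(maximalRealSubfield L)) L (IsCMField.complexConj L) 2 Jstar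
          (K.1.1.map (MulAut.conj (gq q)).toMonoidHom)).map (Matrix.GeneralLinearGroup.map τ))
    (𝔣 : ConeFrame L Jstar (cmPlace L τ))
    {Φ : letI : Algebra L ℂ := τ.toAlgebra
      complexBetti ((Literature.AlgebraicGeometry.Motives.baseChangeHom τ).obj (S.M.obj K)) 1 →ₗ[ℂ] ((adelicGroupData (↥(maximalRealSubfield L)) L (IsCMField.complexConj L) 2 Jstar).Adelic → ℂ)}
    (hΦ : letI : Algebra L ℂ := τ.toAlgebra
      ∀ z : complexBetti ((Literature.AlgebraicGeometry.Motives.baseChangeHom τ).obj (S.M.obj K)) 1,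
        let v₀ : Fin 2 → ℂ := fun i => embTwist L τ (𝔣.v₀ i)
        let t₀ : Fin 2 → ℂ := fun i => embTwist L τ (𝔣.t₀ i)
        (∀ (δ : ↥(rational (↥(maximalRealSubfield L)) L (IsCMField.complexConj L) 2 Jstar)) (x : (adelicGroupData (↥(maximalRealSubfield L)) L (IsCMField.complexConj L) 2 Jstar).Adelic),
          Φ z ((adelicGroupData (↥(maximalRealSubfield L)) L (IsCMField.complexConj L) 2 Jstar).toAdelic δ * x) = Φ z x) ∧
        (∀ k ∈ ((archAt (↥(maximalRealSubfield L)) L (IsCMField.complexConj L) 2 Jstar (cmPlace L τ)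
              (UnitaryGroup.complexConj_smul_infinitePlace L _) (IsCMField.complexConj_ne_one L)).ker).map
            (archToAdelic (↥(maximalRealSubfield L)) L (IsCMField.complexConj L) 2 Jstar),
          ∀ x : (adelicGroupData (↥(maximalRealSubfield L)) L (IsCMField.complexConj L) 2 Jstar).Adelic, Φ z (x * k) = Φ z x) ∧
        (∀ k ∈ K.1.1, ∀ x : (adelicGroupData (↥(maximalRealSubfield L)) L (IsCMField.complexConj L) 2 Jstar).Adelic,
          Φ z (x * finAdelicToAdelic (↥(maximalRealSubfield L)) L (IsCMField.complexConj L) 2 Jstar k) = Φ z x) ∧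
        ∀ (q : orbitRel.Quotient ↥(rational (↥(maximalRealSubfield L)) L (IsCMField.complexConj L) 2 Jstar)
          (ShimuraDissection.CosetSpace (rationalToFinAdelic (↥(maximalRealSubfield L)) L (IsCMField.complexConj L) 2 Jstar) K.1.1))
          (u : archLocal L 2 Jstar (cmPlace L τ)),
          Φ z (adelicSingle (↥(maximalRealSubfield L)) L (IsCMField.complexConj L) 2 Jstar (IsCMField.complexConj_ne_one L)
              (UnitaryGroup.complexConj_smul_infinitePlace L) (cmPlace L τ) u *
            finAdelicToAdelic (↥(maximalRealSubfield L)) L (IsCMField.complexConj L) 2 Jstar (gq q)) =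
          (((algebraicModel (B q).isSmoothProjective).oneFormOfClass (B q).isSmoothProjective (algebraicModel (B q).isSmoothProjective).holFormsClosed_top (((algebraicModel (B q).isSmoothProjective).complexification (B q).isSmoothProjective 1).symm ((algebraicModel (B q).isSmoothProjective).pullbackEquiv 1 ((algebraicModel (B q).isSmoothProjective).typeProj 1 ⟨(1, 0), Finset.HasAntidiagonal.mem_antidiagonal.2 rfl⟩ (complexBetti.map (ι q) 1 z)))) : MForm 𝓘(ℝ, (algebraicModel (B q).isSmoothProjective).model) (algebraicModel (B q).isSmoothProjective).carrier ℂ 1)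
          ((⇑(algebraicModel (B q).isSmoothProjective).isAnalytification.homeomorph.symm ∘ (B q).unif)
            ((((u : GL (Fin 2) ℂ) : Matrix (Fin 2) (Fin 2) ℂ).map (embTwist L τ)) *ᵥ v₀))
          (fun _ ↦ mfderiv 𝓘(ℝ, Fin 2 → ℂ) 𝓘(ℝ, (algebraicModel (B q).isSmoothProjective).model)
            (⇑(algebraicModel (B q).isSmoothProjective).isAnalytification.homeomorph.symm ∘ (B q).unif)
            ((((u : GL (Fin 2) ℂ) : Matrix (Fin 2) (Fin 2) ℂ).map (embTwist L τ)) *ᵥ v₀)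
            ((((u : GL (Fin 2) ℂ) : Matrix (Fin 2) (Fin 2) ℂ).map (embTwist L τ)) *ᵥ t₀))))
    {z : letI : Algebra L ℂ := τ.toAlgebra; complexBetti ((Literature.AlgebraicGeometry.Motives.baseChangeHom τ).obj (S.M.obj K)) 1}
    (hz : letI : Algebra L ℂ := τ.toAlgebra; Φ z + conjFun₂ (↥(maximalRealSubfield L)) L (IsCMField.complexConj L) Jstar (Φ (conjClass _ 1 z)) = 0) :
    z = 0 := by
  letI : Algebra L ℂ := τ.toAlgebra
  have hcov := cover_of_representatives (K := K.1.1) (hgq := hgq)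
  -- Step 1: both summands vanish (disjoint Hodge types; orientation by cases on Mathlib's embedding of the place of `τ`)
  have hboth : Φ z = 0 ∧ Φ (conjClass _ 1 z) = 0 := by
    -- with no piece the target is zero
    rcases isEmpty_or_nonempty (orbitRel.Quotient ↥(rational (↥(maximalRealSubfield L)) L (IsCMField.complexConj L) 2 Jstar)
          (ShimuraDissection.CosetSpace (rationalToFinAdelic (↥(maximalRealSubfield L)) L (IsCMField.complexConj L) 2 Jstar) K.1.1)) with hQ | ⟨⟨q₀⟩⟩
    · have hz0 : ∀ w : complexBetti ((Literature.AlgebraicGeometry.Motives.baseChangeHom τ).obj (S.M.obj K)) 1, w = 0 := fun w =>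
        Summit.HodgeConjecture.CorCM.D2Bridge.complexBetti_eq_zero_of_forall_map_inj hcol fun q => (IsEmpty.false q).elim
      exact ⟨by rw [hz0 z, map_zero], by rw [hz0 (conjClass _ 1 z), map_zero]⟩
    have hJ := isHermitian_map_embedding_of_Hℂ_eq L Jstar τ (B q₀) (hB q₀).1
    have hD := Summit.HodgeConjecture.HodgeConjecture.Cruxes.HLiu418.CurveHodgeTypesDisjoint.disjoint_holCotForms₂_map_conjFun₂
      (↥(maximalRealSubfield L)) L (IsCMField.complexConj L) Jstar (IsCMField.complexConj_ne_one L) (UnitaryGroup.complexConj_smul_infinitePlace L) (cmPlace L τ) hJ 𝔣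
    by_cases hemb : (InfinitePlace.mk τ).embedding = τ
    · have hhol : ∀ w : complexBetti ((Literature.AlgebraicGeometry.Motives.baseChangeHom τ).obj (S.M.obj K)) 1, Φ w ∈ holCotForms₂ (↥(maximalRealSubfield L)) L (IsCMField.complexConj L) Jstar (IsCMField.complexConj_ne_one L) (UnitaryGroup.complexConj_smul_infinitePlace L) (cmPlace L τ) 𝔣 := fun w =>
        lift_mem_holCotForms₂_of_embedding_eq hemb 𝔣 (coneFrame_v₀_eq L Jstar τ 𝔣) (coneFrame_t₀_eq L Jstar τ 𝔣) (fun q => (hB q).1)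
          (fun q => algebraicModel (B q).isSmoothProjective)
          (fun q => ((algebraicModel (B q).isSmoothProjective).oneFormOfClass (B q).isSmoothProjective (algebraicModel (B q).isSmoothProjective).holFormsClosed_top (((algebraicModel (B q).isSmoothProjective).complexification (B q).isSmoothProjective 1).symm ((algebraicModel (B q).isSmoothProjective).pullbackEquiv 1 ((algebraicModel (B q).isSmoothProjective).typeProj 1 ⟨(1, 0), Finset.HasAntidiagonal.mem_antidiagonal.2 rfl⟩ (complexBetti.map (ι q) 1 w)))) : MForm 𝓘(ℝ, (algebraicModel (B q).isSmoothProjective).model) (algebraicModel (B q).isSmoothProjective).carrier ℂ 1))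
          (fun q => Literature.Geometry.Kaehler.isHolomorphicInCharts_of_mem _) hcov (hΦ w).1 (hΦ w).2.1 (hΦ w).2.2.1 (hΦ w).2.2.2
      obtain ⟨h1, h2⟩ := eq_zero_of_disjoint_of_add_eq_zero hD (hhol z) (Submodule.mem_map.2 ⟨_, hhol _, rfl⟩) hz
      refine ⟨h1, ?_⟩
      rw [← conjFun₂_conjFun₂ _ _ _ _ (Φ (conjClass _ 1 z)), h2, map_zero]
    · have hhol : ∀ w : complexBetti ((Literature.AlgebraicGeometry.Motives.baseChangeHom τ).obj (S.M.obj K)) 1, conjFun₂ (↥(maximalRealSubfield L)) L (IsCMField.complexConj L) Jstar (Φ w) ∈ holCotForms₂ (↥(maximalRealSubfield L)) L (IsCMField.complexConj L) Jstar (IsCMField.complexConj_ne_one L) (UnitaryGroup.complexConj_smul_infinitePlace L) (cmPlace L τ) 𝔣 := fun w =>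
        conjFun₂_lift_mem_holCotForms₂_of_embedding_ne hemb 𝔣 (coneFrame_v₀_eq L Jstar τ 𝔣) (coneFrame_t₀_eq L Jstar τ 𝔣) (fun q => (hB q).1)
          (fun q => algebraicModel (B q).isSmoothProjective)
          (fun q => ((algebraicModel (B q).isSmoothProjective).oneFormOfClass (B q).isSmoothProjective (algebraicModel (B q).isSmoothProjective).holFormsClosed_top (((algebraicModel (B q).isSmoothProjective).complexification (B q).isSmoothProjective 1).symm ((algebraicModel (B q).isSmoothProjective).pullbackEquiv 1 ((algebraicModel (B q).isSmoothProjective).typeProj 1 ⟨(1, 0), Finset.HasAntidiagonal.mem_antidiagonal.2 rfl⟩ (complexBetti.map (ι q) 1 w)))) : MForm 𝓘(ℝ, (algebraicModel (B q).isSmoothProjective).model) (algebraicModel (B q).isSmoothProjective).carrier ℂ 1))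
          (fun q => Literature.Geometry.Kaehler.isHolomorphicInCharts_of_mem _) hcov (hΦ w).1 (hΦ w).2.1 (hΦ w).2.2.1 (hΦ w).2.2.2
      rw [add_comm] at hz
      obtain ⟨h2, h1⟩ := eq_zero_of_disjoint_of_add_eq_zero hD (hhol _)
        (Submodule.mem_map.2 ⟨_, hhol z, conjFun₂_conjFun₂ _ _ _ _ (Φ z)⟩) hz
      refine ⟨h1, ?_⟩
      rw [← conjFun₂_conjFun₂ _ _ _ _ (Φ (conjClass _ 1 z)), h2, map_zero]
  -- Step 2: every piece restriction vanishes (★ R6c, u-form), Step 3: cofan detection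
  refine Summit.HodgeConjecture.CorCM.D2Bridge.complexBetti_eq_zero_of_forall_map_inj hcol fun q => ?_
  refine UnitaryBallUniformisationDatum.eq_zero_of_forall_coneRead_archLocal_eq_zero (B q)
    (algebraicModel (B q).isSmoothProjective) (algebraicModel (B q).isSmoothProjective).holFormsClosed_top (hB q).1
    (embTwist_v₀_mem_negCone L Jstar τ 𝔣) (embTwist_t₀_ne_smul L Jstar τ 𝔣) (complexBetti.map (ι q) 1 z) (fun u => ?_) (fun u => ?_)
  · rw [← (hΦ z).2.2.2 q u, hboth.1]
    rfl
  · rw [conjClass_complexBetti_map, ← (hΦ (conjClass _ 1 z)).2.2.2 q u, hboth.2]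
    rfl

/-! ## §5 Two levels: the Hecke clause (H) — `f⁰_K[T_g^* z] = R(g) f⁰_{K'}[z]` -/

set_option maxHeartbeats 1600000 in
/-- **(H) for the record side**: for a Hecke translate `T_g : M_K ⟶ M_{K'}` (`S.IsHeckeTranslate K K' g T_g`, `g⁻¹ K g ⊆ K'`), pieces data at
both levels and `(1,0)`-lift maps `Ψ = Φ_K`, `Φ = Φ_{K'}`:  `Ψ[T_g^* z] + conj Ψ[conj T_g^* z] = R(g) (Φ[z] + conj Φ[conj z])` — the `(1,0)`
parts by ★ F2-H∕M4 `lift_heckePullback_eq_rightTranslate` (piece sections matched by ★ `exists_rep_inv_mul_mem`), the conjugate parts because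
`conj` commutes with pull-back (★ `conjClass_complexBetti_map`) and with right translation (★ `conjFun₂_rightRep₂`).
[cite: Liu2021, §4.2 l. 2066–2081] [cite: Milne2005ShimuraVarieties, Thm. 13.6 p. 118] [cite: BorelJacquet1979, §4.3] -/
theorem addConj_heckePullback {K' : C5.SmallLevel K₀}
    {gq' : orbitRel.Quotient ↥(rational (↥(maximalRealSubfield L)) L (IsCMField.complexConj L) 2 Jstar)
          (ShimuraDissection.CosetSpace (rationalToFinAdelic (↥(maximalRealSubfield L)) L (IsCMField.complexConj L) 2 Jstar) K'.1.1) →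
      ↥(finAdelic (↥(maximalRealSubfield L)) L (IsCMField.complexConj L) 2 Jstar)}
    {X' : orbitRel.Quotient ↥(rational (↥(maximalRealSubfield L)) L (IsCMField.complexConj L) 2 Jstar)
          (ShimuraDissection.CosetSpace (rationalToFinAdelic (↥(maximalRealSubfield L)) L (IsCMField.complexConj L) 2 Jstar) K'.1.1) →
      SchemeOver ℂ}
    {ι' : ∀ q', X' q' ⟶ (letI : Algebra L ℂ := τ.toAlgebra; (Literature.AlgebraicGeometry.Motives.baseChangeHom τ).obj (S.M.obj K'))}
    {B' : ∀ q', UnitaryBallUniformisationDatum 1 (X' q')}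
    {g : ↥(finAdelic (↥(maximalRealSubfield L)) L (IsCMField.complexConj L) 2 Jstar)} {Tg : S.M.obj K ⟶ S.M.obj K'}
    (hT : S.IsHeckeTranslate K K' g Tg) (hKK' : ∀ k ∈ K.1.1, g⁻¹ * k * g ∈ K'.1.1)
    (hgq : ∀ q, Quotient.mk'' (ShimuraDissection.CosetSpace.pt
      (rationalToFinAdelic (↥(maximalRealSubfield L)) L (IsCMField.complexConj L) 2 Jstar) K.1.1 (gq q)) = q)
    (hgq' : ∀ q, Quotient.mk'' (ShimuraDissection.CosetSpace.pt
      (rationalToFinAdelic (↥(maximalRealSubfield L)) L (IsCMField.complexConj L) 2 Jstar) K'.1.1 (gq' q)) = q)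
    (hB : letI : Algebra L ℂ := τ.toAlgebra
      ∀ q, (B q).Hℂ = Jstar.map τ ∧
      (B q).Γ.map (Matrix.GeneralLinearGroup.map ((B q).τ₁ : ↥(B q).E →+* ℂ)) =
        (arithmeticLevel (↥(maximalRealSubfield L)) L (IsCMField.complexConj L) 2 Jstar
          (K.1.1.map (MulAut.conj (gq q)).toMonoidHom)).map (Matrix.GeneralLinearGroup.map τ) ∧
      ∀ (v : Fin 2 → ℂ) (hv : v ∈ negCone (Jstar.map τ)),
        AlgPoints.map (ι q) ((B q).unif v) =
          AlgPoints.baseChangeEquiv τ (S.M.obj K) ((S.pts K).symm (ShimuraSetGS.mk L Jstar τ K.1.1 v hv (gq q))))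
    (hB' : letI : Algebra L ℂ := τ.toAlgebra
      ∀ q', (B' q').Hℂ = Jstar.map τ ∧
      (B' q').Γ.map (Matrix.GeneralLinearGroup.map ((B' q').τ₁ : ↥(B' q').E →+* ℂ)) =
        (arithmeticLevel (↥(maximalRealSubfield L)) L (IsCMField.complexConj L) 2 Jstar
          (K'.1.1.map (MulAut.conj (gq' q')).toMonoidHom)).map (Matrix.GeneralLinearGroup.map τ) ∧
      ∀ (v : Fin 2 → ℂ) (hv : v ∈ negCone (Jstar.map τ)),
        AlgPoints.map (ι' q') ((B' q').unif v) =
          AlgPoints.baseChangeEquiv τ (S.M.obj K') ((S.pts K').symm (ShimuraSetGS.mk L Jstar τ K'.1.1 v hv (gq' q'))))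
    (𝔣 : ConeFrame L Jstar (cmPlace L τ))
    {Φ : letI : Algebra L ℂ := τ.toAlgebra
      complexBetti ((Literature.AlgebraicGeometry.Motives.baseChangeHom τ).obj (S.M.obj K')) 1 →ₗ[ℂ] ((adelicGroupData (↥(maximalRealSubfield L)) L (IsCMField.complexConj L) 2 Jstar).Adelic → ℂ)}
    (hΦ : letI : Algebra L ℂ := τ.toAlgebra
      ∀ z : complexBetti ((Literature.AlgebraicGeometry.Motives.baseChangeHom τ).obj (S.M.obj K')) 1,
        let v₀ : Fin 2 → ℂ := fun i => embTwist L τ (𝔣.v₀ i)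
        let t₀ : Fin 2 → ℂ := fun i => embTwist L τ (𝔣.t₀ i)
        (∀ (δ : ↥(rational (↥(maximalRealSubfield L)) L (IsCMField.complexConj L) 2 Jstar)) (x : (adelicGroupData (↥(maximalRealSubfield L)) L (IsCMField.complexConj L) 2 Jstar).Adelic),
          Φ z ((adelicGroupData (↥(maximalRealSubfield L)) L (IsCMField.complexConj L) 2 Jstar).toAdelic δ * x) = Φ z x) ∧
        (∀ k ∈ ((archAt (↥(maximalRealSubfield L)) L (IsCMField.complexConj L) 2 Jstar (cmPlace L τ)
              (UnitaryGroup.complexConj_smul_infinitePlace L _) (IsCMField.complexConj_ne_one L)).ker).map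
            (archToAdelic (↥(maximalRealSubfield L)) L (IsCMField.complexConj L) 2 Jstar),
          ∀ x : (adelicGroupData (↥(maximalRealSubfield L)) L (IsCMField.complexConj L) 2 Jstar).Adelic, Φ z (x * k) = Φ z x) ∧
        (∀ k ∈ K'.1.1, ∀ x : (adelicGroupData (↥(maximalRealSubfield L)) L (IsCMField.complexConj L) 2 Jstar).Adelic,
          Φ z (x * finAdelicToAdelic (↥(maximalRealSubfield L)) L (IsCMField.complexConj L) 2 Jstar k) = Φ z x) ∧
        ∀ (q' : orbitRel.Quotient ↥(rational (↥(maximalRealSubfield L)) L (IsCMField.complexConj L) 2 Jstar)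
          (ShimuraDissection.CosetSpace (rationalToFinAdelic (↥(maximalRealSubfield L)) L (IsCMField.complexConj L) 2 Jstar) K'.1.1))
          (u : archLocal L 2 Jstar (cmPlace L τ)),
          Φ z (adelicSingle (↥(maximalRealSubfield L)) L (IsCMField.complexConj L) 2 Jstar (IsCMField.complexConj_ne_one L)
              (UnitaryGroup.complexConj_smul_infinitePlace L) (cmPlace L τ) u *
            finAdelicToAdelic (↥(maximalRealSubfield L)) L (IsCMField.complexConj L) 2 Jstar (gq' q')) =
          (((algebraicModel (B' q').isSmoothProjective).oneFormOfClass (B' q').isSmoothProjective (algebraicModel (B' q').isSmoothProjective).holFormsClosed_top (((algebraicModel (B' q').isSmoothProjective).complexification (B' q').isSmoothProjective 1).symm ((algebraicModel (B' q').isSmoothProjective).pullbackEquiv 1 ((algebraicModel (B' q').isSmoothProjective).typeProj 1 ⟨(1, 0), Finset.HasAntidiagonal.mem_antidiagonal.2 rfl⟩ (complexBetti.map (ι' q') 1 z)))) : MForm 𝓘(ℝ, (algebraicModel (B' q').isSmoothProjective).model) (algebraicModel (B' q').isSmoothProjective).carrier ℂ 1)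
          ((⇑(algebraicModel (B' q').isSmoothProjective).isAnalytification.homeomorph.symm ∘ (B' q').unif)
            ((((u : GL (Fin 2) ℂ) : Matrix (Fin 2) (Fin 2) ℂ).map (embTwist L τ)) *ᵥ v₀))
          (fun _ ↦ mfderiv 𝓘(ℝ, Fin 2 → ℂ) 𝓘(ℝ, (algebraicModel (B' q').isSmoothProjective).model)
            (⇑(algebraicModel (B' q').isSmoothProjective).isAnalytification.homeomorph.symm ∘ (B' q').unif)
            ((((u : GL (Fin 2) ℂ) : Matrix (Fin 2) (Fin 2) ℂ).map (embTwist L τ)) *ᵥ v₀)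
            ((((u : GL (Fin 2) ℂ) : Matrix (Fin 2) (Fin 2) ℂ).map (embTwist L τ)) *ᵥ t₀))))
    {Ψ : letI : Algebra L ℂ := τ.toAlgebra
      complexBetti ((Literature.AlgebraicGeometry.Motives.baseChangeHom τ).obj (S.M.obj K)) 1 →ₗ[ℂ] ((adelicGroupData (↥(maximalRealSubfield L)) L (IsCMField.complexConj L) 2 Jstar).Adelic → ℂ)}
    (hΨ : letI : Algebra L ℂ := τ.toAlgebra
      ∀ w : complexBetti ((Literature.AlgebraicGeometry.Motives.baseChangeHom τ).obj (S.M.obj K)) 1,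
        let v₀ : Fin 2 → ℂ := fun i => embTwist L τ (𝔣.v₀ i)
        let t₀ : Fin 2 → ℂ := fun i => embTwist L τ (𝔣.t₀ i)
        (∀ (δ : ↥(rational (↥(maximalRealSubfield L)) L (IsCMField.complexConj L) 2 Jstar)) (x : (adelicGroupData (↥(maximalRealSubfield L)) L (IsCMField.complexConj L) 2 Jstar).Adelic),
          Ψ w ((adelicGroupData (↥(maximalRealSubfield L)) L (IsCMField.complexConj L) 2 Jstar).toAdelic δ * x) = Ψ w x) ∧
        (∀ k ∈ ((archAt (↥(maximalRealSubfield L)) L (IsCMField.complexConj L) 2 Jstar (cmPlace L τ)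
              (UnitaryGroup.complexConj_smul_infinitePlace L _) (IsCMField.complexConj_ne_one L)).ker).map
            (archToAdelic (↥(maximalRealSubfield L)) L (IsCMField.complexConj L) 2 Jstar),
          ∀ x : (adelicGroupData (↥(maximalRealSubfield L)) L (IsCMField.complexConj L) 2 Jstar).Adelic, Ψ w (x * k) = Ψ w x) ∧
        (∀ k ∈ K.1.1, ∀ x : (adelicGroupData (↥(maximalRealSubfield L)) L (IsCMField.complexConj L) 2 Jstar).Adelic,
          Ψ w (x * finAdelicToAdelic (↥(maximalRealSubfield L)) L (IsCMField.complexConj L) 2 Jstar k) = Ψ w x) ∧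
        ∀ (q : orbitRel.Quotient ↥(rational (↥(maximalRealSubfield L)) L (IsCMField.complexConj L) 2 Jstar)
          (ShimuraDissection.CosetSpace (rationalToFinAdelic (↥(maximalRealSubfield L)) L (IsCMField.complexConj L) 2 Jstar) K.1.1))
          (u : archLocal L 2 Jstar (cmPlace L τ)),
          Ψ w (adelicSingle (↥(maximalRealSubfield L)) L (IsCMField.complexConj L) 2 Jstar (IsCMField.complexConj_ne_one L)
              (UnitaryGroup.complexConj_smul_infinitePlace L) (cmPlace L τ) u *
            finAdelicToAdelic (↥(maximalRealSubfield L)) L (IsCMField.complexConj L) 2 Jstar (gq q)) =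
          (((algebraicModel (B q).isSmoothProjective).oneFormOfClass (B q).isSmoothProjective (algebraicModel (B q).isSmoothProjective).holFormsClosed_top (((algebraicModel (B q).isSmoothProjective).complexification (B q).isSmoothProjective 1).symm ((algebraicModel (B q).isSmoothProjective).pullbackEquiv 1 ((algebraicModel (B q).isSmoothProjective).typeProj 1 ⟨(1, 0), Finset.HasAntidiagonal.mem_antidiagonal.2 rfl⟩ (complexBetti.map (ι q) 1 w)))) : MForm 𝓘(ℝ, (algebraicModel (B q).isSmoothProjective).model) (algebraicModel (B q).isSmoothProjective).carrier ℂ 1)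
          ((⇑(algebraicModel (B q).isSmoothProjective).isAnalytification.homeomorph.symm ∘ (B q).unif)
            ((((u : GL (Fin 2) ℂ) : Matrix (Fin 2) (Fin 2) ℂ).map (embTwist L τ)) *ᵥ v₀))
          (fun _ ↦ mfderiv 𝓘(ℝ, Fin 2 → ℂ) 𝓘(ℝ, (algebraicModel (B q).isSmoothProjective).model)
            (⇑(algebraicModel (B q).isSmoothProjective).isAnalytification.homeomorph.symm ∘ (B q).unif)
            ((((u : GL (Fin 2) ℂ) : Matrix (Fin 2) (Fin 2) ℂ).map (embTwist L τ)) *ᵥ v₀)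
            ((((u : GL (Fin 2) ℂ) : Matrix (Fin 2) (Fin 2) ℂ).map (embTwist L τ)) *ᵥ t₀))))
    (z : letI : Algebra L ℂ := τ.toAlgebra; complexBetti ((Literature.AlgebraicGeometry.Motives.baseChangeHom τ).obj (S.M.obj K')) 1) :
    letI : Algebra L ℂ := τ.toAlgebra
    Ψ (complexBetti.map ((Literature.AlgebraicGeometry.Motives.baseChangeHom τ).map Tg) 1 z) +
        conjFun₂ (↥(maximalRealSubfield L)) L (IsCMField.complexConj L) Jstar
          (Ψ (conjClass _ 1 (complexBetti.map ((Literature.AlgebraicGeometry.Motives.baseChangeHom τ).map Tg) 1 z))) =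
      rightRep₂ (↥(maximalRealSubfield L)) L (IsCMField.complexConj L) Jstar g (Φ z + conjFun₂ (↥(maximalRealSubfield L)) L (IsCMField.complexConj L) Jstar (Φ (conjClass _ 1 z))) := by
  letI : Algebra L ℂ := τ.toAlgebra
  have hcov := cover_of_representatives (K := K.1.1) (hgq := hgq)
  choose γ q' hγ using fun q => exists_rep_inv_mul_mem hgq' (gq q) g
  -- the `(1,0)` parts
  have h10 : ∀ w : complexBetti ((Literature.AlgebraicGeometry.Motives.baseChangeHom τ).obj (S.M.obj K')) 1,
      Ψ (complexBetti.map ((Literature.AlgebraicGeometry.Motives.baseChangeHom τ).map Tg) 1 w) = rightRep₂ (↥(maximalRealSubfield L)) L (IsCMField.complexConj L) Jstar g (Φ w) := by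
    intro w
    funext x
    rw [rightRep₂_apply]
    have e : ∀ q, complexBetti.map (ι q ≫ (Literature.AlgebraicGeometry.Motives.baseChangeHom τ).map Tg) 1 w =
        complexBetti.map (ι q) 1 (complexBetti.map ((Literature.AlgebraicGeometry.Motives.baseChangeHom τ).map Tg) 1 w) := fun q => by
      rw [complexBetti.map_comp]
      rfl
    refine lift_heckePullback_eq_rightTranslate hT hKK' hB hB' hcov hγ w (embTwist_v₀_mem_negCone L Jstar τ 𝔣) _
      (hΦ w).1 (hΦ w).2.1 (hΦ w).2.2.1 (hΦ w).2.2.2 (hΨ _).1 (hΨ _).2.1 (hΨ _).2.2.1 (fun q u => ?_) x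
    rw [e q]
    exact (hΨ _).2.2.2 q u
  rw [map_add, ← conjFun₂_rightRep₂, ← h10, ← h10, conjClass_complexBetti_map]

/-! ## §6 The GS fold: `S1LevelRealisationShape` (M5-glue) -/

section Fold

open Summit.HodgeConjecture.CorCM (CMField)
open Summit.HodgeConjecture.CorCM.Lines.A3Liu418
open Literature.NumberTheory.Automorphic.Liu2021 Literature.NumberTheory.Automorphic.Liu2021.AppendixC

/-- A `ℂ`-linear map `Φ` and the conjugate-linear `conj`, `conjClass` assemble into the `ℂ`-LINEAR `z ↦ Φ z + conj (Φ (conj z))`. [folklore] [cite: VoisinHodgeI2002, §7.1.1] -/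
theorem exists_addConj_linearMap {L : Type} [Field L] [NumberField L] [IsCMField L] {Jstar : Matrix (Fin 2) (Fin 2) L} {M' : SchemeOver ℂ}
    (Φ : complexBetti M' 1 →ₗ[ℂ] ((adelicGroupData (↥(maximalRealSubfield L)) L (IsCMField.complexConj L) 2 Jstar).Adelic → ℂ)) :
    ∃ f : complexBetti M' 1 →ₗ[ℂ] ((adelicGroupData (↥(maximalRealSubfield L)) L (IsCMField.complexConj L) 2 Jstar).Adelic → ℂ),
      ∀ z, f z = Φ z + conjFun₂ (↥(maximalRealSubfield L)) L (IsCMField.complexConj L) Jstar (Φ (conjClass _ 1 z)) :=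
  ⟨{ toFun := fun z => Φ z + conjFun₂ (↥(maximalRealSubfield L)) L (IsCMField.complexConj L) Jstar (Φ (conjClass _ 1 z))
     map_add' := fun z z' => by
       simp only [conjClass_add, map_add]
       abel
     map_smul' := fun a z => by
       simp only [conjClass_smul, map_smul, LinearMap.map_smulₛₗ, starRingEnd_self_apply, smul_add, RingHom.id_apply] },
    fun _ => rfl⟩

set_option maxHeartbeats 1600000 in
/-- **M5-glue — `stub_S1_levelRealisation` of `Lines/F0_AlbCmS1Betti.lean` (ed. 2)**: the level-wise, Hecke-compatible, injective,
`cohForms₂`-valued realisation `f_K = f⁰_K ∘ tr_K` of the GS Betti levels `H¹(A_K(ℂ); ℂ)`: `tr_K` = ★ M5-tr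
`BettiLevelRecordTransport.exists_bettiLevelRecordTransport` (Albanese `H¹` comparison + GS∕record level comparison, injective, Hecke-natural),
`f⁰_K[z] = Φ_K[z] + conj Φ_K[conj z]` the record-side realisation of §4–§5 over the pieces of ★ `RecordSystemGS.pieces` and the `(1,0)`-lift maps of
§2 (frame `(𝔣.v₀, 𝔣.t₀)` untwisted to `ι₁`-coordinates).  (V) `addConj_mem_cohForms₂`; (I) `eq_zero_of_addConj_eq_zero`; (H) `addConj_heckePullback`
at the record's chosen translates (★ `isHeckeTranslate_recordHeckeTranslateGS`).
[cite: Liu2021, §D.3 l. 5300–5359 and §4.2 l. 2066–2081] [cite: BorelWallach2000, VII 3.2 and XIII 1.2] [cite: Borel1997, §5.14] -/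
theorem s1LevelRealisation
    (F : CMField) (ι₁ : F →+* ℂ) (Jstar : Matrix (Fin 2) (Fin 2) (F : Type))
    (K₀ : C5.OpenCompactSubgroup ↥(finAdelic ↥(maximalRealSubfield (F : Type)) (F : Type) (IsCMField.complexConj (F : Type)) 2 Jstar))
    (S : RecordSystemGS (F : Type) Jstar ι₁ K₀) (hU7ₛ : S.HeckeTranslateDefinedOver)
    (h4 : 4 ≤ Module.finrank ℚ (F : Type)) (isoₛ : ℕ → Prop)
    (𝔣 : ConeFrame (F : Type) Jstar (cmPlace (F : Type) ι₁)) :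
    ∃ f : ∀ K : C5.SmallLevel (sec42DataGS S h4 isoₛ).S.K₀,
        (sec42DataGS S h4 isoₛ).bettiH1 ι₁ K →ₗ[ℂ]
          ((adelicGroupData ↥(maximalRealSubfield (F : Type)) (F : Type) (IsCMField.complexConj (F : Type)) 2 Jstar).Adelic → ℂ),
      (∀ (K : C5.SmallLevel (sec42DataGS S h4 isoₛ).S.K₀) (y : (sec42DataGS S h4 isoₛ).bettiH1 ι₁ K),
          f K y ∈ cohForms₂ ↥(maximalRealSubfield (F : Type)) (F : Type) (IsCMField.complexConj (F : Type)) Jstar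
            (IsCMField.complexConj_ne_one (F : Type)) (UnitaryGroup.complexConj_smul_infinitePlace (F : Type))
            (cmPlace (F : Type) ι₁) 𝔣) ∧
      (∀ K : C5.SmallLevel (sec42DataGS S h4 isoₛ).S.K₀, Function.Injective (f K)) ∧
      ∀ (g : (sec42DataGS S h4 isoₛ).G) (K K' : C5.SmallLevel (sec42DataGS S h4 isoₛ).S.K₀) (h : C5.HeckeLE g K K')
        (y : (sec42DataGS S h4 isoₛ).bettiH1 ι₁ K'),
        f K (bettiPullAlong ι₁ ((sec42HeckeTranslatesGS S hU7ₛ h4 isoₛ).albTr g K K' h) y) =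
          rightRep₂ ↥(maximalRealSubfield (F : Type)) (F : Type) (IsCMField.complexConj (F : Type)) Jstar g (f K' y) := by
  classical
  -- pieces at every level (★ `RecordSystemGS.pieces`)
  choose gq hgq X ι hcol B hB using S.pieces
  -- the `(1,0)`-lift maps at every level (§2), frame untwisted to `ι₁`-coordinates
  have hlift := fun K : C5.SmallLevel K₀ =>
    exists_oneZeroLiftMap (S := S) (ι := ι K) (B := B K) (hgq K) (fun q => ⟨(hB K q).1, (hB K q).2.1⟩)
      (embTwist_v₀_mem_negCone (F : Type) Jstar ι₁ 𝔣) (fun i => embTwist (F : Type) ι₁ (𝔣.t₀ i))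
  choose Φ hΦ using hlift
  -- `f⁰_K = Φ_K + conj ∘ Φ_K ∘ conj` as linear maps
  have hf0 := fun K : C5.SmallLevel K₀ => exists_addConj_linearMap (Jstar := Jstar) (Φ K)
  choose f₀ hf₀ using hf0
  -- ★ M5-tr
  obtain ⟨tr, htr, htrH⟩ := BettiLevelRecordTransport.exists_bettiLevelRecordTransport S hU7ₛ h4 isoₛ
  refine ⟨fun K => (f₀ K).comp (tr K), fun K y => ?_, fun K => ?_, fun g K K' h y => ?_⟩
  · -- (V)
    rw [LinearMap.comp_apply, hf₀]
    exact addConj_mem_cohForms₂ (hgq K) (fun q => (hB K q).1) 𝔣 (hΦ K) _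
  · -- (I)
    show Function.Injective ((f₀ K).comp (tr K))
    rw [LinearMap.coe_comp]
    refine Function.Injective.comp ((injective_iff_map_eq_zero (f₀ K)).2 fun z hz => ?_) (htr K)
    rw [hf₀] at hz
    exact eq_zero_of_addConj_eq_zero (hgq K) (hcol K) (fun q => ⟨(hB K q).1, (hB K q).2.1⟩) 𝔣 (hΦ K) hz
  · -- (H)
    rw [LinearMap.comp_apply, LinearMap.comp_apply, htrH, hf₀, hf₀]
    exact addConj_heckePullback (isHeckeTranslate_recordHeckeTranslateGS S hU7ₛ g K K' h) h (hgq K) (hgq K') (hB K) (hB K') 𝔣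
      (hΦ K') (hΦ K) (tr K' y)

end Fold

end Summit.HodgeConjecture.HodgeConjecture.Cruxes.HLiu418.S1LevelRealisation
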